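import Mathlib
import HarnessLib
import Summits.HubbardSuperconductivity.HubbardSuperconductivity.Theorems.FunctionFieldCertificateWindowInfraredBoundStubShellCover

/-!
# Crux `WindowInfraredBound` (stmt-HubbardSuperconductivity-1089), line `dyadic-halving-cascade`:
# the composition as a tree theorem — (Dbl) in every sector ground state ⇒ the crux

The line `dyadic-halving-cascade` (card `Cruxes/WindowInfraredBound/Ideas/dyadic-halving-cascade.md`,
skeleton `Cruxes/WindowInfraredBound/Lines/dyadic_halving_cascade.lean`) reduces the crux to ONE physics
input, the halving inequality on smooth Littlewood–Paley shells of the `d`-wave pair structure factor of a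
normalised `(N_L, S^z = 0)`-sector ground state,

  (Dbl)  `Σ_{m≠0} φ(|q_m|/ρ) S_ψ(m) ≤ ½ Σ_{m≠0} φ(|q_m|/(2ρ)) S_ψ(m) + B₁ ρ² L² + B₂ L`,  `0 < ρ ≤ ε₀/2`,
  `φ(u) = max 0 (1 − |log₂ u|)`,

through the LANDED single-state cover-and-cascade `stub_shellCover` (p107924). This file lands the
composition itself, so that the sixth reduction of the crux is an importable theorem like the other five
(`wib_of_goldstoneShape`, `wib_of_pairYrastFloorOne`, `wib_of_pairRemovalFloor_of_pairConvexity`,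
`wib_of_torusPairStiffness_of_chargingFloor`, `wib_of_pairGaussianDomination_of_chargingFloor`):

* `wib_of_dyadicHalving : (Dbl for every sector GS, ∀ (U,δ)) → FunctionFieldCertificate.WindowInfraredBound`
  (constants `ε₀ ↦ ε₀/2`, `C = 8(32 + B₁ε₀²)/ε₀ + 4B₂`), `kacWib_of_dyadicHalving` (the `Iff.rfl` Kac copy);
* composed with `infraredLeak_of_windowInfraredBound` (p108857) it also gives the infrared LEAK that route
  `FunctionFieldCertificate` actually consumes (one line; recorded as a comment below).

(Dbl) itself is NOT claimed: it is an open `T = 0` infrared statement about exact doped-Hubbard ground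
states (scale-ratio form of "infrared exponent ≤ 1"; no reflection positivity off half filling, no
block-RG control in print), recorded as the line's single open stub `stub_dyadicHalving`.
Sources: Kennedy–Lieb–Shastry, PRL 61 (1988) 2582 [KLS1988PRL] (Parseval anchor / infrared-bound shape);
T. Balaban, CMP 167 (1995) 103, CMP 182 (1996) 675 (the supplier CLASS for scale-recursive bounds; nothing
there proves (Dbl) for the Hubbard model). Folklore real analysis otherwise; no definition, no named fact.
-/

namespace Summit.HubbardSuperconductivity.HubbardSuperconductivity.Theorems.WindowInfraredBound

-- summit = problem name (single-conjunct summit, D-0017): `HubbardSuperconductivity` occurs twice in the path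
set_option linter.dupNamespace false

open Literature.MathematicalPhysics.QuantumLattice Literature.Probability.LatticeModels Matrix Finset
open scoped ComplexOrder ComplexConjugate
open Summit.HubbardSuperconductivity.HubbardSuperconductivity.Theses

/-- **The dyadic line closes the crux modulo (Dbl): `wib_of_dyadicHalving`.** If for all `U > 0`,
`δ ∈ (0,1/2)` there are `B₁, B₂ ≥ 0`, `ε₀ > 0`, `L₀` such that every normalised `(N_L, 0)`-sector ground
state of `hubbardTorus 2 L 1 U` on every even torus `L ≥ L₀` obeys the shell-halving inequality (Dbl) at
all scales `0 < ρ ≤ ε₀/2`, then `FunctionFieldCertificate.WindowInfraredBound` holds, with window radius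
`ε₀/2` and constant `C = 8(32 + B₁ε₀²)/ε₀ + 4B₂` (single-state cover + cascade `stub_shellCover`, read in tree
vocabulary through `wib_iff_pairStructureFactor`). [folklore] -/
theorem wib_of_dyadicHalving :
    (∀ U : ℝ, 0 < U → ∀ δ ∈ Set.Ioo (0:ℝ) (1 / 2), ∃ B₁ B₂ ε₀ : ℝ, 0 ≤ B₁ ∧ 0 ≤ B₂ ∧ 0 < ε₀ ∧ ∃ L₀ : ℕ,
      ∀ (L : ℕ) [NeZero L], L₀ ≤ L → Even L → ∀ ψ : Fock (Orb (FermionTorus 2 L)), star ψ ⬝ᵥ ψ = 1 →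
        IsGroundStateInSector (hubbardTorus 2 L 1 U) (2 * ⌊(1 - δ) * (L : ℝ) ^ 2 / 2⌋₊) 0 ψ →
          ∀ ρ ∈ Set.Ioc (0:ℝ) (ε₀ / 2),
            (∑ m : TorusSite 2 L, if m ≠ 0 then
                max 0 (1 - |Real.logb 2 (Real.sqrt (momentumNormSq L m) / ρ)|) *
                  pairStructureFactor dWaveFormFactor L ψ m else 0) ≤
              (∑ m : TorusSite 2 L, if m ≠ 0 then
                  max 0 (1 - |Real.logb 2 (Real.sqrt (momentumNormSq L m) / (2 * ρ))|) *
                    pairStructureFactor dWaveFormFactor L ψ m else 0) / 2 +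
                B₁ * ρ ^ 2 * (L : ℝ) ^ 2 + B₂ * (L : ℝ)) →
    FunctionFieldCertificate.WindowInfraredBound := by
  intro hDbl
  refine wib_iff_pairStructureFactor.2 fun U hU δ hδ => ?_
  obtain ⟨B₁, B₂, ε₀, hB₁, hB₂, hε₀, L₀, h⟩ := hDbl U hU δ hδ
  refine ⟨8 * (32 + B₁ * ε₀ ^ 2) / ε₀ + 4 * B₂, ε₀ / 2, by positivity, by positivity, L₀, ?_⟩
  intro ε hε L _ hL hev ψ hψ hgs
  exact stub_shellCover L ψ hψ hB₁ hB₂ hε.1 hε.2 (h L hL hev ψ hψ hgs)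

/-- The `KacWindowPenalty` copy of the crux from (Dbl) (verbatim the same proposition,
`wib_functionField_iff_kac`). [folklore] -/
theorem kacWib_of_dyadicHalving :
    (∀ U : ℝ, 0 < U → ∀ δ ∈ Set.Ioo (0:ℝ) (1 / 2), ∃ B₁ B₂ ε₀ : ℝ, 0 ≤ B₁ ∧ 0 ≤ B₂ ∧ 0 < ε₀ ∧ ∃ L₀ : ℕ,
      ∀ (L : ℕ) [NeZero L], L₀ ≤ L → Even L → ∀ ψ : Fock (Orb (FermionTorus 2 L)), star ψ ⬝ᵥ ψ = 1 →
        IsGroundStateInSector (hubbardTorus 2 L 1 U) (2 * ⌊(1 - δ) * (L : ℝ) ^ 2 / 2⌋₊) 0 ψ →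
          ∀ ρ ∈ Set.Ioc (0:ℝ) (ε₀ / 2),
            (∑ m : TorusSite 2 L, if m ≠ 0 then
                max 0 (1 - |Real.logb 2 (Real.sqrt (momentumNormSq L m) / ρ)|) *
                  pairStructureFactor dWaveFormFactor L ψ m else 0) ≤
              (∑ m : TorusSite 2 L, if m ≠ 0 then
                  max 0 (1 - |Real.logb 2 (Real.sqrt (momentumNormSq L m) / (2 * ρ))|) *
                    pairStructureFactor dWaveFormFactor L ψ m else 0) / 2 +
                B₁ * ρ ^ 2 * (L : ℝ) ^ 2 + B₂ * (L : ℝ)) →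
    KacWindowPenalty.WindowInfraredBound := fun hDbl =>
  wib_functionField_iff_kac.1 (wib_of_dyadicHalving hDbl)

/- Corollary (not landed here to keep this module's imports minimal): with
`infraredLeak_of_windowInfraredBound` (p108857, `Theorems/FunctionFieldCertificateWindowInfraredBoundInfraredLeak.lean`),
`infraredLeak_of_windowInfraredBound (wib_of_dyadicHalving hDbl)` is the infrared LEAK that route
`FunctionFieldCertificate` consumes (`summit_of_mesoscopicPairOrder_of_infraredLeak`). -/

end Summit.HubbardSuperconductivity.HubbardSuperconductivity.Theorems.WindowInfraredBound
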